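import Literature.Barriers.AnomalousDissipation.ObukhovCorrsinThresholdProofs
import Literature.Analysis.FluidPDE.PassiveScalarEnergyProofs
import HarnessLib

/-!
# The Obukhov–Corrsin threshold: the energy hypothesis is redundant above the line
(barrier audit 2026-08-17, gen 9, of `Barriers/AnomalousDissipation/ObukhovCorrsinThreshold`)

The named fact `Literature.Barriers.AnomalousDissipation.DrivasElgindiIyerJeong2022_thm4`
(Drivas–Elgindi–Iyer–Jeong, ARMA 243 (2022), Thm. 4) carries the energy balance (1.2) of the
source as an explicit hypothesis `_henergy` (scope caveat (iv) of the block: "for rough unbounded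
(Sobolev) fields the energy hypothesis is a genuine selection"). This file proves that INSIDE
the technique class and ABOVE the threshold the hypothesis is automatic: for a divergence-free
`u ∈ L¹(0,T; C^{0,α})`, a datum `θ₀ ∈ C^{0,β}` and ANY weak solution
`θ ∈ L^∞(0,T; L²)` (`Torus.IsWeakScalarTransportOn`, distributional, no parabolic regularity
built in) with `ess sup_t ‖θ(t)‖_{C^{0,β}} ≤ M` and `α + 2β > 1`, `κ ≥ 0`, one has for a.e. `t`
`‖θ(t)‖²₂ + 2κ∫₀ᵗ‖∇θ‖²₂ ≤ ‖θ₀‖²₂`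
(`DrivasElgindiIyerJeong2022_thm4.energy_ineq_of_holder`). Consequently the conclusion of the
named fact holds for every weak solution of the class, with no energy hypothesis, as soon as
`α + 2β > 1` (`DrivasElgindiIyerJeong2022_thm4_of_supercritical`, from the discharge
`DrivasElgindiIyerJeong2022_thm4_holds`): "wild" (non-Leray) weak solutions of the
advection–diffusion equation cannot evade the obstruction while staying uniformly Hölder above
the line — the selection question of caveat (iv) arises only below the line or outside Hölder
classes.

## Proof

Mollify in space, `A_ε = θ ⋆ k_ε`. The mollified energy identity with datum
(`IsWeakScalarTransportOn.ae_integral_sq_molInt_eq`, `PassiveScalarEnergyMollified`) and the slice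
identity `∫ A G = ∫ θ⟪u, ∇B⟫ - κ‖∇A‖²` (`Torus.integral_conv_mul_flux_eq`) give, for a.e. `t`,
`‖A_ε(t)‖² + 2κ∫₀ᵗ‖∇A_ε‖² = ‖θ₀ ⋆ k_ε‖² + 2∫₀ᵗ∫ θ⟪u, ∇B_ε⟫`, and the commutator form of the
transport pairing with the Constantin–E–Titi sup estimates
(`Torus.integral_mul_inner_gradient_conv_conv_eq_sum`, `Torus.abs_partialDeriv_convolution_kernel_le`,
`Torus.abs_commutator_le`; exactly the bound (5.10) of the source without its resolved-dissipation
term) bounds the last integrand by `2 d C₁ M² [u(s)]_α ε^{α+2β-1}`. Hence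
`‖θ(t)‖² + 2κ∫₀ᵗ‖∇A_ε‖² ≤ ‖θ₀‖² + 4dC₁M²‖u‖_{L¹C^α} ε^{α+2β-1} + 2M²ε^β`
(`|A_ε(t) - θ(t)| ≤ Mε^β`), and `ε → 0` with the lower semicontinuity of the spectral gradient
norm (`Torus.mul_eScalarGradNormSq_le_liminf`) and Fatou in time concludes, since
`α + 2β - 1 > 0`. This is the Onsager-type commutator argument of Constantin–E–Titi 1994 run on
the scalar energy, in the a.e.-in-time form of the tree's weak solutions (blueprint of
`IsWeakScalarTransportOn.energy_ineq_holds`, `PassiveScalarEnergyProofs`, where `u` is bounded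
instead).

## References

* T. D. Drivas, T. M. Elgindi, G. Iyer, I.-J. Jeong, Arch. Ration. Mech. Anal. 243 (2022)
  1151–1180 (arXiv:1911.03271), (1.2), Thm. 4 and its proof, §5, (5.8)–(5.10). Bib key
  `DrivasEtAl2022`.
* P. Constantin, W. E, E. S. Titi, Comm. Math. Phys. 165 (1994), 207–209, (6)–(11). Bib key
  `ConstantinETiti1994`.
-/

open MeasureTheory Set Filter Topology
open scoped ENNReal NNReal Convolution InnerProductSpace

noncomputable section

namespace Literature.Barriers.AnomalousDissipation

open Literature.Analysis Literature.Analysis.FunctionSpaces Literature.Analysis.FluidPDE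

/-- **Above the Obukhov–Corrsin line every uniformly Hölder weak solution obeys the energy
inequality** (barrier audit 2026-08-17, gen 9). Let `u ∈ L¹(0,T; C^{0,α}(T^d))` be divergence
free (weakly, a.e. in time — part of `Torus.IsWeakScalarTransportOn`), `θ₀ ∈ C^{0,β}` with
`‖θ₀‖_{C^{0,β}} ≤ M`, `κ ≥ 0`, and let `θ ∈ L^∞(0,T; L²)` be ANY weak solution of
`∂ₜθ + u·∇θ = κΔθ`, `θ(0) = θ₀` on `T^d × [0,T)` with `ess sup_t ‖θ(t)‖_{C^{0,β}} ≤ M`. If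
`α + 2β > 1` then for a.e. `t ∈ (0,T)`,
`‖θ(t)‖²_{L²} + 2κ ∫₀ᵗ ‖∇θ‖²_{L²} ≤ ‖θ₀‖²_{L²}` — the hypothesis `_henergy` of
`DrivasElgindiIyerJeong2022_thm4`, in exactly its shape. (Mollified energy identity, the
Constantin–E–Titi commutator bound `|∫∇θ̄_ε·τ_ε(u,θ)| ≤ 2dC₁[θ]²_β[u]_α ε^{α+2β-1}`, and
`ε → 0` by lower semicontinuity of the spectral gradient norm and Fatou.) [folklore] -/
theorem DrivasElgindiIyerJeong2022_thm4.energy_ineq_of_holder {d : Type*} [Fintype d]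
    [DecidableEq d] {T : ℝ} {α β : ℝ≥0} (hβ : 0 < β) (hOC : 1 < (α : ℝ) + 2 * β) {M : ℝ≥0}
    {u : ℝ → UnitAddTorus d → EuclideanSpace ℝ d} (hu : MemLpHolder 1 α u (Ioo 0 T))
    {θ₀ : UnitAddTorus d → ℝ} (hθ₀ : eBoundedHolderNorm β θ₀ ≤ M) {κ : ℝ} (hκ : 0 ≤ κ)
    {θ : ℝ → UnitAddTorus d → ℝ} (hθ : Torus.IsWeakScalarTransportOn T κ u θ₀ θ)
    (hbound : ∀ᵐ t ∂((volume : Measure ℝ).restrict (Ioo 0 T)), eBoundedHolderNorm β (θ t) ≤ M) :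
    ∀ᵐ t ∂((volume : Measure ℝ).restrict (Ioo 0 T)),
      (∫⁻ x, ‖θ t x‖ₑ ^ 2) + 2 * Torus.eScalarDissipation κ θ 0 t ≤ ∫⁻ x, ‖θ₀ x‖ₑ ^ 2 := by
  set μT : Measure ℝ := (volume : Measure ℝ).restrict (Ioo 0 T) with hμT
  haveI : IsFiniteMeasure μT := by rw [hμT]; infer_instance
  -- Hölder data: constant, continuity and sup bound from `‖f‖_{C^{0,β}} ≤ M`
  have hMtop : ((M : ℝ≥0∞)) < ⊤ := ENNReal.coe_lt_top
  have nn_le : ∀ {f : UnitAddTorus d → ℝ}, eBoundedHolderNorm β f ≤ M →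
      HolderWith M β f ∧ Continuous f ∧ ∀ x, |f x| ≤ M := by
    intro f hf
    have hB : MemBoundedHolder β f := lt_of_le_of_lt hf hMtop
    refine ⟨Torus.holderWith_of_nnHolderNorm_le hB.memHolder (ENNReal.coe_le_coe.1 ?_),
      hB.continuous hβ, fun x => ?_⟩
    · rw [hB.memHolder.coe_nnHolderNorm_eq_eHolderNorm]
      exact (eHolderNorm_le_eBoundedHolderNorm β f).trans hf
    · have h1 : ‖f x‖ₑ ≤ M :=
        (enorm_le_eSupNorm f x).trans ((eSupNorm_le_eBoundedHolderNorm β f).trans hf)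
      have h2 := ENNReal.toReal_mono ENNReal.coe_ne_top h1
      rw [toReal_enorm, ENNReal.coe_toReal, Real.norm_eq_abs] at h2
      exact h2
  have hθ₀c : Continuous θ₀ := (nn_le hθ₀).2.1
  have hθ₀i : Integrable θ₀ volume := hθ₀c.integrable_unitAddTorus
  -- radii and kernels
  obtain ⟨hε, hε', hε0⟩ := Torus.molRadius_spec
  set ε : ℕ → ℝ := fun n => 1 / (4 * ((n : ℝ) + 1)) with hε_def
  have hkS : ∀ n, Torus.IsSmooth (Torus.kernel (d := d) (ε n)) :=
    fun n => Torus.isSmooth_kernel (hε n) (hε' n)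
  have hk1 : ∀ n, ∫⁻ y, ‖Torus.kernel (d := d) (ε n) y‖ₑ = 1 :=
    fun n => Torus.lintegral_enorm_kernel (hε n) (hε' n)
  -- constants
  set C₁ : ℝ := Torus.gradProfileMass d with hC₁
  have hC₁0 : 0 ≤ C₁ := Torus.gradProfileMass_nonneg
  have hM0 : (0 : ℝ) ≤ M := M.coe_nonneg
  set P : ℕ → ℝ := fun n => (ε n)⁻¹ * C₁ * ((M : ℝ) * (ε n) ^ (β : ℝ)) with hP_def
  have hP0 : ∀ n, 0 ≤ P n := fun n =>
    mul_nonneg (mul_nonneg (inv_nonneg.2 (hε n).le) hC₁0) (mul_nonneg hM0 (Real.rpow_nonneg (hε n).le _))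
  set c : ℕ → ℝ := fun n => 2 * Fintype.card d * C₁ * (M : ℝ) ^ 2 * (ε n) ^ ((α : ℝ) + 2 * β - 1)
    with hc_def
  have hc0 : ∀ n, 0 ≤ c n := fun n =>
    mul_nonneg (by positivity) (Real.rpow_nonneg (hε n).le _)
  have hexp : ∀ n, (ε n)⁻¹ * (ε n) ^ (β : ℝ) * (ε n) ^ (α : ℝ) * (ε n) ^ (β : ℝ) =
      (ε n) ^ ((α : ℝ) + 2 * β - 1) := by
    intro n
    rw [← Real.rpow_neg_one (ε n), ← Real.rpow_add (hε n), ← Real.rpow_add (hε n),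
      ← Real.rpow_add (hε n)]
    congr 1
    ring
  -- the `L¹_t C^α` norm of the velocity
  set K' : ℝ≥0∞ := eLpHolderNorm 1 α u (Ioo 0 T) with hK'
  have hK't : K' ≠ ⊤ := hu.2.ne
  have hKint : ∫⁻ s in Ioo 0 T, ENNReal.ofReal (boundedHolderNorm α (u s)) = K' := by
    rw [hK', eLpHolderNorm, eLpNorm_one_eq_lintegral_enorm]
    refine lintegral_congr fun s => ?_
    exact (Real.enorm_eq_ofReal ENNReal.toReal_nonneg).symm
  -- good slices
  have hgood : ∀ᵐ s ∂μT, (HolderWith M β (θ s) ∧ Continuous (θ s) ∧ ∀ x, |θ s x| ≤ M) ∧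
      MemBoundedHolder α (u s) ∧ Torus.IsWeaklyDivFree (u s) ∧
      AEStronglyMeasurable (u s) volume ∧ MemLp (θ s) 2 volume := by
    filter_upwards [hbound, hu.1, hθ.ae_isWeaklyDivFree, hθ.ae_aestronglyMeasurable_velocity_slice,
      hθ.ae_memLp_two] with s h1 h2 h3 h4 h5
    exact ⟨nn_le h1, h2, h3, h4, h5⟩
  -- the mollified quantities
  set g : ℕ → ℝ → ℝ := fun n s =>
    ∫ x, ‖(θ s ⋆ Torus.gradient (Torus.kernel (ε n))) x‖ ^ 2 with hg_def
  set Φ : ℕ → ℝ → ℝ := fun n s => ∫ x, (θ s ⋆ Torus.kernel (ε n)) x * ∫ y, θ s y *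
    (-⟪u s y, Torus.gradient (Torus.kernel (ε n)) (x - y)⟫_ℝ +
      κ * Torus.laplacian (Torus.kernel (ε n)) (x - y)) with hΦ_def
  have hgm : ∀ n, AEStronglyMeasurable (g n) μT := fun n =>
    hθ.aestronglyMeasurable_integral_norm_sq_conv_gradient (hkS n)
  have hg0 : ∀ n s, 0 ≤ g n s := fun n s => integral_nonneg fun x => sq_nonneg _
  -- `g n ≤ d P²` a.e., hence integrable on `(0,T)`
  have hgle : ∀ n, ∀ᵐ s ∂μT, g n s ≤ Fintype.card d * P n ^ 2 := by
    intro n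
    filter_upwards [hgood] with s hs
    obtain ⟨⟨hθsH, hθsc, -⟩, -, -, -, -⟩ := hs
    have hθsi : Integrable (θ s) volume := hθsc.integrable_unitAddTorus
    have hA : Torus.IsSmooth (θ s ⋆ Torus.kernel (ε n)) := Torus.isSmooth_convolution hθsi (hkS n)
    have hA1 : Torus.IsContDiff 1 (θ s ⋆ Torus.kernel (ε n)) := hA.isContDiff (by simp)
    have hPj : ∀ j x, |Torus.partialDeriv j (θ s ⋆ Torus.kernel (ε n)) x| ≤ P n := fun j x =>
      Torus.abs_partialDeriv_convolution_kernel_le hθsi hθsH (hε n) (hε' n) j x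
    have hgrad : ∀ x, Torus.gradient (θ s ⋆ Torus.kernel (ε n)) x =
        (θ s ⋆ Torus.gradient (Torus.kernel (ε n))) x :=
      fun x => Torus.gradient_convolution hθsi (hkS n) x
    have hpt : ∀ x, ‖(θ s ⋆ Torus.gradient (Torus.kernel (ε n))) x‖ ^ 2 ≤ Fintype.card d * P n ^ 2 := by
      intro x
      rw [← hgrad x, EuclideanSpace.norm_sq_eq]
      calc ∑ j, ‖Torus.gradient (θ s ⋆ Torus.kernel (ε n)) x j‖ ^ 2 ≤ ∑ _j : d, P n ^ 2 := by
            refine Finset.sum_le_sum fun j _ => ?_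
            rw [Torus.gradient_apply hA1, Real.norm_eq_abs]
            exact pow_le_pow_left₀ (abs_nonneg _) (hPj j x) 2
        _ = Fintype.card d * P n ^ 2 := by
            rw [Finset.sum_const, Finset.card_univ, nsmul_eq_mul]
    have hc : Continuous fun x => ‖(θ s ⋆ Torus.gradient (Torus.kernel (ε n))) x‖ :=
      (Torus.continuous_convolution hθsi (hkS n).gradient.continuous).norm
    calc g n s ≤ ∫ _x : UnitAddTorus d, (Fintype.card d * P n ^ 2 : ℝ) := by
          refine integral_mono (hc.pow 2).integrable_unitAddTorus (integrable_const _) fun x => ?_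
          exact hpt x
      _ = Fintype.card d * P n ^ 2 := by simp
  have hgi : ∀ n, Integrable (g n) μT := by
    intro n
    refine Integrable.mono' (integrable_const (Fintype.card d * P n ^ 2)) (hgm n) ?_
    filter_upwards [hgle n] with s hs
    rw [Real.norm_eq_abs, abs_of_nonneg (hg0 n s)]
    exact hs
  -- **the slice bound**: `Φ + κ g = ∫ θ⟪u, ∇B⟫ ≤ c n · ‖u(s)‖_{C^{0,α}}` for a.e. `s`
  have hslice : ∀ n, ∀ᵐ s ∂μT, Φ n s + κ * g n s ≤ c n * boundedHolderNorm α (u s) := by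
    intro n
    filter_upwards [hgood] with s hs
    obtain ⟨⟨hθsH, hθsc, -⟩, hsu, hdiv, hum, -⟩ := hs
    have hθsi : Integrable (θ s) volume := hθsc.integrable_unitAddTorus
    have huH : HolderWith (nnHolderNorm α (u s)) α (u s) := hsu.memHolder.holderWith
    have hCv : ∀ y, ‖u s y‖ ≤ (eSupNorm (u s)).toReal := fun y => by
      rw [← toReal_enorm]
      exact ENNReal.toReal_mono hsu.eSupNorm_lt_top.ne (enorm_le_eSupNorm (u s) y)
    have hle : ((nnHolderNorm α (u s) : ℝ≥0) : ℝ) ≤ boundedHolderNorm α (u s) :=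
      ENNReal.toReal_mono hsu.ne (eHolderNorm_le_eBoundedHolderNorm α (u s))
    have hn0 : 0 ≤ ((nnHolderNorm α (u s) : ℝ≥0) : ℝ) := NNReal.coe_nonneg _
    -- the flux pairing splits into transport pairing minus resolved dissipation
    have hflux := Torus.integral_conv_mul_flux_eq hθsi hum (Eventually.of_forall hCv) (hε n) (hε' n) κ
    have hgrad : ∀ x, Torus.gradient (θ s ⋆ Torus.kernel (ε n)) x =
        (θ s ⋆ Torus.gradient (Torus.kernel (ε n))) x :=
      fun x => Torus.gradient_convolution hθsi (hkS n) x
    have hJ_eq : Φ n s + κ * g n s = ∫ y, θ s y *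
        ⟪u s y, Torus.gradient ((θ s ⋆ Torus.kernel (ε n)) ⋆ Torus.kernel (ε n)) y⟫_ℝ := by
      simp only [hΦ_def, hg_def, ← hgrad]
      rw [hflux]
      ring
    -- the transport pairing in commutator form, bounded by `d P Q`
    set Q : ℝ := 2 * (((nnHolderNorm α (u s) : ℝ≥0) : ℝ) * (ε n) ^ (α : ℝ) * ((M : ℝ) * (ε n) ^ (β : ℝ)))
      with hQ
    have hvI := fun j => Torus.integrable_apply_mul_of_norm_le hθsc hum hCv j
    have hPj : ∀ j x, |Torus.partialDeriv j (θ s ⋆ Torus.kernel (ε n)) x| ≤ P n := fun j x =>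
      Torus.abs_partialDeriv_convolution_kernel_le hθsi hθsH (hε n) (hε' n) j x
    have hτ : ∀ j x, |((fun y => u s y j * θ s y) ⋆ Torus.kernel (ε n)) x -
        ((fun y => u s y j) ⋆ Torus.kernel (ε n)) x * (θ s ⋆ Torus.kernel (ε n)) x| ≤ Q :=
      fun j x => Torus.abs_commutator_le (hvI j).2.1 hθsi (hvI j).2.2
        (Torus.holderWith_apply huH j) hθsH (hε n) (hε' n) x
    have hJ : |∫ y, θ s y *
        ⟪u s y, Torus.gradient ((θ s ⋆ Torus.kernel (ε n)) ⋆ Torus.kernel (ε n)) y⟫_ℝ| ≤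
        Fintype.card d * P n * Q := by
      rw [Torus.integral_mul_inner_gradient_conv_conv_eq_sum hθsc hum hCv hdiv (hε n) (hε' n)]
      refine (Finset.abs_sum_le_sum_abs _ _).trans ?_
      have hj : ∀ j, |∫ x, Torus.partialDeriv j (θ s ⋆ Torus.kernel (ε n)) x *
          (((fun y => u s y j * θ s y) ⋆ Torus.kernel (ε n)) x -
            ((fun y => u s y j) ⋆ Torus.kernel (ε n)) x * (θ s ⋆ Torus.kernel (ε n)) x)| ≤
          P n * Q := by
        intro j
        have h := norm_integral_le_of_norm_le (μ := (volume : Measure (UnitAddTorus d)))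
          (f := fun x => Torus.partialDeriv j (θ s ⋆ Torus.kernel (ε n)) x *
            (((fun y => u s y j * θ s y) ⋆ Torus.kernel (ε n)) x -
              ((fun y => u s y j) ⋆ Torus.kernel (ε n)) x * (θ s ⋆ Torus.kernel (ε n)) x))
          (integrable_const (P n * Q)) (Eventually.of_forall fun x => by
            rw [norm_mul, Real.norm_eq_abs, Real.norm_eq_abs]
            exact mul_le_mul (hPj j x) (hτ j x) (abs_nonneg _) (hP0 n))
        simpa using h
      calc ∑ j, |∫ x, Torus.partialDeriv j (θ s ⋆ Torus.kernel (ε n)) x *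
            (((fun y => u s y j * θ s y) ⋆ Torus.kernel (ε n)) x -
              ((fun y => u s y j) ⋆ Torus.kernel (ε n)) x * (θ s ⋆ Torus.kernel (ε n)) x)|
          ≤ ∑ _j : d, P n * Q := Finset.sum_le_sum fun j _ => hj j
        _ = Fintype.card d * P n * Q := by
            rw [Finset.sum_const, Finset.card_univ, nsmul_eq_mul]
            ring
    have hPQ : Fintype.card d * P n * Q = c n * ((nnHolderNorm α (u s) : ℝ≥0) : ℝ) := by
      rw [hc_def, hP_def, hQ]
      dsimp only
      rw [← hexp n]
      ring
    calc Φ n s + κ * g n s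
        = ∫ y, θ s y * ⟪u s y, Torus.gradient ((θ s ⋆ Torus.kernel (ε n)) ⋆ Torus.kernel (ε n)) y⟫_ℝ :=
          hJ_eq
      _ ≤ |∫ y, θ s y * ⟪u s y, Torus.gradient ((θ s ⋆ Torus.kernel (ε n)) ⋆ Torus.kernel (ε n)) y⟫_ℝ| :=
          le_abs_self _
      _ ≤ Fintype.card d * P n * Q := hJ
      _ = c n * ((nnHolderNorm α (u s) : ℝ≥0) : ℝ) := hPQ
      _ ≤ c n * boundedHolderNorm α (u s) := mul_le_mul_of_nonneg_left hle (hc0 n)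
  -- `L²` convergence of the mollified slices, and measurability of the spectral integrand
  have hE0 : ∀ᵐ s ∂μT, Tendsto (fun n => eLpNorm (θ s ⋆ Torus.kernel (ε n) - θ s) 2 volume)
      atTop (𝓝 0) := by
    filter_upwards [hgood] with s hs
    exact Torus.tendsto_eLpNorm_convolution_sub_self hs.2.2.2.2
      (fun n y => Torus.kernel_nonneg (hε n).le y)
      (fun n => Torus.integral_kernel (hε n) (hε' n)) (fun n => Torus.support_kernel_subset (hε n))
      (fun n => Torus.continuous_kernel (hε n) (hε' n)) hε0
  have hGrad : ∀ n, ∀ᵐ s ∂μT, Torus.eScalarGradNormSq (θ s ⋆ Torus.kernel (ε n)) =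
      ENNReal.ofReal (g n s) := by
    intro n
    filter_upwards [hgood] with s hs
    have hθsi : Integrable (θ s) volume := hs.1.2.1.integrable_unitAddTorus
    have hA : Torus.IsSmooth (θ s ⋆ Torus.kernel (ε n)) := Torus.isSmooth_convolution hθsi (hkS n)
    have hgrad : ∀ x, Torus.gradient (θ s ⋆ Torus.kernel (ε n)) x =
        (θ s ⋆ Torus.gradient (Torus.kernel (ε n))) x :=
      fun x => Torus.gradient_convolution hθsi (hkS n) x
    rw [Torus.eScalarGradNormSq_eq_ofReal_integral hA]
    simp only [hgrad, hg_def]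
  have hAEm : ∀ n, AEMeasurable (fun s => ENNReal.ofReal (2 * κ) *
      Torus.eScalarGradNormSq (θ s ⋆ Torus.kernel (ε n))) μT := by
    intro n
    refine ((hgm n).aemeasurable.ennreal_ofReal.const_mul (ENNReal.ofReal (2 * κ))).congr ?_
    filter_upwards [hGrad n] with s hs
    rw [hs]
  -- the datum term
  set a : ℝ≥0∞ := ∫⁻ x, ‖θ₀ x‖ₑ ^ 2 with ha_def
  have ha0 : ∀ n, ENNReal.ofReal (∫ x, (θ₀ ⋆ Torus.kernel (ε n)) x ^ 2) ≤ a := by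
    intro n
    have hc : Continuous (θ₀ ⋆ Torus.kernel (ε n)) := Torus.continuous_convolution hθ₀i (hkS n).continuous
    rw [← Torus.lintegral_enorm_sq_eq_ofReal_integral_sq hc, ← PassiveScalarProofs.eLpNorm_two_pow_two, ha_def,
      ← PassiveScalarProofs.eLpNorm_two_pow_two]
    gcongr
    calc eLpNorm (θ₀ ⋆ Torus.kernel (ε n)) 2 volume
        ≤ (∫⁻ y, ‖Torus.kernel (ε n) y‖ₑ) * eLpNorm θ₀ 2 volume :=
          Torus.eLpNorm_convolution_le hθ₀c.aestronglyMeasurable (hkS n).continuous.aestronglyMeasurable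
            one_le_two
      _ = eLpNorm θ₀ 2 volume := by rw [hk1 n, one_mul]
  -- the vanishing error `e n = 2 (c n) K' + 2M·Mεⁿ^β`
  have hlim_c : Tendsto (fun n => ENNReal.ofReal (c n) * K') atTop (𝓝 0) := by
    have h1 : Tendsto (fun n => (ε n) ^ ((α : ℝ) + 2 * β - 1)) atTop (𝓝 0) := by
      have h := hε0.rpow_const (p := (α : ℝ) + 2 * β - 1) (Or.inr (by linarith))
      rwa [Real.zero_rpow (by linarith)] at h
    have h2 : Tendsto c atTop (𝓝 0) := by
      have h := h1.const_mul (2 * Fintype.card d * C₁ * (M : ℝ) ^ 2)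
      rw [mul_zero] at h
      exact h
    have h3 : Tendsto (fun n => ENNReal.ofReal (c n)) atTop (𝓝 0) := by
      have h := ENNReal.tendsto_ofReal h2
      rwa [ENNReal.ofReal_zero] at h
    have h4 := ENNReal.Tendsto.mul_const h3 (Or.inr hK't)
    rwa [zero_mul] at h4
  have hlim_M : Tendsto (fun n => ENNReal.ofReal (2 * (M : ℝ) * ((M : ℝ) * (ε n) ^ (β : ℝ)))) atTop (𝓝 0) := by
    have hβ' : (0 : ℝ) < β := hβ
    have h1 : Tendsto (fun n => (ε n) ^ (β : ℝ)) atTop (𝓝 0) := by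
      have h := hε0.rpow_const (p := (β : ℝ)) (Or.inr hβ'.le)
      rwa [Real.zero_rpow hβ'.ne'] at h
    have h2 : Tendsto (fun n => 2 * (M : ℝ) * ((M : ℝ) * (ε n) ^ (β : ℝ))) atTop (𝓝 0) := by
      have h := (h1.const_mul (M : ℝ)).const_mul (2 * (M : ℝ))
      rw [mul_zero, mul_zero] at h
      exact h
    have h := ENNReal.tendsto_ofReal h2
    rwa [ENNReal.ofReal_zero] at h
  have he0 : Tendsto (fun n => 2 * (ENNReal.ofReal (c n) * K') +
      ENNReal.ofReal (2 * (M : ℝ) * ((M : ℝ) * (ε n) ^ (β : ℝ)))) atTop (𝓝 0) := by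
    have h1 := ENNReal.Tendsto.const_mul hlim_c (Or.inr ENNReal.ofNat_ne_top : (0 : ℝ≥0∞) ≠ 0 ∨ (2 : ℝ≥0∞) ≠ ⊤)
    rw [mul_zero] at h1
    have h := h1.add hlim_M
    rwa [add_zero] at h
  -- **the estimate at a.e. time `t`**
  filter_upwards [ae_all_iff.2 fun n => hθ.ae_integral_sq_molInt_eq hθ₀i (hkS n),
    ae_restrict_mem measurableSet_Ioo, hbound] with t hid htT hbt
  obtain ⟨hθtH, hθtc, hθtM⟩ := nn_le hbt
  have hθti : Integrable (θ t) volume := hθtc.integrable_unitAddTorus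
  have hsub : Ioc 0 t ⊆ Ioo 0 T := Ioc_subset_Ioo_right htT.2
  have hsub' : Ioo 0 t ⊆ Ioo 0 T := Ioo_subset_Ioo_right htT.2.le
  have hX : ∫⁻ x, ‖θ t x‖ₑ ^ 2 = ENNReal.ofReal (∫ x, θ t x ^ 2) :=
    Torus.lintegral_enorm_sq_eq_ofReal_integral_sq hθtc
  -- per-`n` bound: `‖θ(t)‖² + 2κ∫₀ᵗ‖∇Aₙ‖² ≤ a + eₙ`
  have hcore : ∀ n, ENNReal.ofReal (∫ x, θ t x ^ 2) + ENNReal.ofReal (2 * κ * ∫ s in Ioc 0 t, g n s) ≤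
      a + (2 * (ENNReal.ofReal (c n) * K') + ENNReal.ofReal (2 * (M : ℝ) * ((M : ℝ) * (ε n) ^ (β : ℝ)))) := by
    intro n
    have hAc : Continuous (θ t ⋆ Torus.kernel (ε n)) := Torus.continuous_convolution hθti (hkS n).continuous
    -- `θ(t)² ≤ Aₙ(t)² + 2M·Mε^β` pointwise, from `|Aₙ(t) - θ(t)| ≤ Mε^β` and `|θ(t)| ≤ M`
    have hpt : ∀ x, θ t x ^ 2 ≤ (θ t ⋆ Torus.kernel (ε n)) x ^ 2 + 2 * (M : ℝ) * ((M : ℝ) * (ε n) ^ (β : ℝ)) := by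
      intro x
      obtain ⟨h1a, h1b⟩ := abs_le.1 (Torus.abs_convolution_kernel_sub_self_le hθti hθtH (hε n) (hε' n) x)
      obtain ⟨h2a, h2b⟩ := abs_le.1 (hθtM x)
      nlinarith [mul_nonneg (sub_nonneg.2 h2b) (sub_nonneg.2 h1b),
        mul_nonneg (show (0 : ℝ) ≤ M + θ t x by linarith)
          (show (0 : ℝ) ≤ (M : ℝ) * (ε n) ^ (β : ℝ) + ((θ t ⋆ Torus.kernel (ε n)) x - θ t x) by linarith),
        sq_nonneg ((θ t ⋆ Torus.kernel (ε n)) x - θ t x)]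
    have hint_t : ∫ x, θ t x ^ 2 ≤ (∫ x, (θ t ⋆ Torus.kernel (ε n)) x ^ 2) +
        2 * (M : ℝ) * ((M : ℝ) * (ε n) ^ (β : ℝ)) := by
      have hi1 : Integrable (fun x => (θ t ⋆ Torus.kernel (ε n)) x ^ 2) volume :=
        (hAc.pow 2).integrable_unitAddTorus
      calc ∫ x, θ t x ^ 2
          ≤ ∫ x, ((θ t ⋆ Torus.kernel (ε n)) x ^ 2 + 2 * (M : ℝ) * ((M : ℝ) * (ε n) ^ (β : ℝ))) :=
            integral_mono (hθtc.pow 2).integrable_unitAddTorus (hi1.add (integrable_const _)) hpt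
        _ = (∫ x, (θ t ⋆ Torus.kernel (ε n)) x ^ 2) + 2 * (M : ℝ) * ((M : ℝ) * (ε n) ^ (β : ℝ)) := by
            rw [integral_add hi1 (integrable_const _)]
            simp
    -- the identity and the slice bound, in real form
    have hΦi : IntegrableOn (Φ n) (Ioc 0 t) volume :=
      (hθ.integrableOn_integral_conv_mul_flux (hkS n)).mono_set hsub
    have hgi' : IntegrableOn (g n) (Ioc 0 t) volume :=
      (show IntegrableOn (g n) (Ioo 0 T) volume from hgi n).mono_set hsub
    have hgI0 : 0 ≤ ∫ s in Ioc 0 t, g n s := integral_nonneg (hg0 n)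
    have hreal : (∫ x, θ t x ^ 2) + 2 * κ * ∫ s in Ioc 0 t, g n s ≤
        (∫ x, (θ₀ ⋆ Torus.kernel (ε n)) x ^ 2) + 2 * (∫ s in Ioc 0 t, (Φ n s + κ * g n s)) +
          2 * (M : ℝ) * ((M : ℝ) * (ε n) ^ (β : ℝ)) := by
      have e : ∫ s in Ioc 0 t, (Φ n s + κ * g n s) =
          (∫ s in Ioc 0 t, Φ n s) + κ * ∫ s in Ioc 0 t, g n s := by
        rw [integral_add hΦi (hgi'.const_mul κ), MeasureTheory.integral_const_mul]
      have hid' : ∫ x, ((θ t) ⋆ Torus.kernel (ε n)) x ^ 2 =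
          (∫ x, (θ₀ ⋆ Torus.kernel (ε n)) x ^ 2) + 2 * ∫ s in Ioc 0 t, Φ n s := hid n
      rw [e]
      linarith
    -- pass to `ℝ≥0∞`
    have hθt0 : 0 ≤ ∫ x, θ t x ^ 2 := integral_nonneg fun x => sq_nonneg _
    have h2κg : 0 ≤ 2 * κ * ∫ s in Ioc 0 t, g n s := mul_nonneg (mul_nonneg zero_le_two hκ) hgI0
    have hmid : ENNReal.ofReal (2 * ∫ s in Ioc 0 t, (Φ n s + κ * g n s)) ≤
        2 * (ENNReal.ofReal (c n) * K') := by
      rw [ENNReal.ofReal_mul zero_le_two, ENNReal.ofReal_ofNat]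
      gcongr
      calc ENNReal.ofReal (∫ s in Ioc 0 t, (Φ n s + κ * g n s))
          ≤ ∫⁻ s in Ioc 0 t, ENNReal.ofReal (Φ n s + κ * g n s) := ofReal_integral_le_lintegral_ofReal _
        _ ≤ ∫⁻ s in Ioc 0 t, ENNReal.ofReal (c n) * ENNReal.ofReal (boundedHolderNorm α (u s)) := by
            refine lintegral_mono_ae (ae_restrict_of_ae_restrict_of_subset hsub ((hslice n).mono fun s hs => ?_))
            rw [← ENNReal.ofReal_mul (hc0 n)]
            exact ENNReal.ofReal_le_ofReal hs
        _ ≤ ∫⁻ s in Ioo 0 T, ENNReal.ofReal (c n) * ENNReal.ofReal (boundedHolderNorm α (u s)) :=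
            lintegral_mono_set hsub
        _ = ENNReal.ofReal (c n) * K' := by
            rw [lintegral_const_mul' _ _ ENNReal.ofReal_ne_top, hKint]
    calc ENNReal.ofReal (∫ x, θ t x ^ 2) + ENNReal.ofReal (2 * κ * ∫ s in Ioc 0 t, g n s)
        = ENNReal.ofReal ((∫ x, θ t x ^ 2) + 2 * κ * ∫ s in Ioc 0 t, g n s) :=
          (ENNReal.ofReal_add hθt0 h2κg).symm
      _ ≤ ENNReal.ofReal ((∫ x, (θ₀ ⋆ Torus.kernel (ε n)) x ^ 2) +
            2 * (∫ s in Ioc 0 t, (Φ n s + κ * g n s)) + 2 * (M : ℝ) * ((M : ℝ) * (ε n) ^ (β : ℝ))) :=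
          ENNReal.ofReal_le_ofReal hreal
      _ ≤ ENNReal.ofReal (∫ x, (θ₀ ⋆ Torus.kernel (ε n)) x ^ 2) +
            ENNReal.ofReal (2 * ∫ s in Ioc 0 t, (Φ n s + κ * g n s)) +
            ENNReal.ofReal (2 * (M : ℝ) * ((M : ℝ) * (ε n) ^ (β : ℝ))) :=
          ENNReal.ofReal_add_le.trans (add_le_add_left ENNReal.ofReal_add_le _)
      _ ≤ a + 2 * (ENNReal.ofReal (c n) * K') +
            ENNReal.ofReal (2 * (M : ℝ) * ((M : ℝ) * (ε n) ^ (β : ℝ))) :=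
          add_le_add_left (add_le_add (ha0 n) hmid) _
      _ = a + (2 * (ENNReal.ofReal (c n) * K') +
            ENNReal.ofReal (2 * (M : ℝ) * ((M : ℝ) * (ε n) ^ (β : ℝ)))) := by rw [add_assoc]
  -- **Fatou**: `2 · eScalarDissipation κ θ 0 t ≤ liminfₙ ofReal (2κ ∫_{(0,t]} gₙ)`
  have h2κ : (2 : ℝ≥0∞) * ENNReal.ofReal κ = ENNReal.ofReal (2 * κ) := by
    rw [ENNReal.ofReal_mul zero_le_two, ENNReal.ofReal_ofNat]
  have hΛ : ∀ n, ∫⁻ s in Ioo 0 t, ENNReal.ofReal (2 * κ) * Torus.eScalarGradNormSq (θ s ⋆ Torus.kernel (ε n)) =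
      ENNReal.ofReal (2 * κ * ∫ s in Ioc 0 t, g n s) := by
    intro n
    have hgi'' : IntegrableOn (g n) (Ioo 0 t) volume :=
      (show IntegrableOn (g n) (Ioo 0 T) volume from hgi n).mono_set hsub'
    rw [lintegral_const_mul' _ _ ENNReal.ofReal_ne_top, integral_Ioc_eq_integral_Ioo,
      ENNReal.ofReal_mul (mul_nonneg zero_le_two hκ),
      ofReal_integral_eq_lintegral_ofReal hgi'' (Eventually.of_forall (hg0 n))]
    congr 1
    refine lintegral_congr_ae (ae_restrict_of_ae_restrict_of_subset hsub' ?_)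
    filter_upwards [hGrad n] with s hs
    exact hs
  have hFatou : 2 * Torus.eScalarDissipation κ θ 0 t ≤
      liminf (fun n => ENNReal.ofReal (2 * κ * ∫ s in Ioc 0 t, g n s)) atTop := by
    have hAEm' : ∀ n, AEMeasurable (fun s => ENNReal.ofReal (2 * κ) *
        Torus.eScalarGradNormSq (θ s ⋆ Torus.kernel (ε n))) ((volume : Measure ℝ).restrict (Ioo 0 t)) :=
      fun n => (hAEm n).mono_measure (Measure.restrict_mono hsub' le_rfl)
    calc 2 * Torus.eScalarDissipation κ θ 0 t
        = ∫⁻ s in Ioo 0 t, ENNReal.ofReal (2 * κ) * Torus.eScalarGradNormSq (θ s) := by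
          rw [Torus.eScalarDissipation, ← mul_assoc, h2κ, lintegral_const_mul' _ _ ENNReal.ofReal_ne_top]
      _ ≤ ∫⁻ s in Ioo 0 t, liminf (fun n => ENNReal.ofReal (2 * κ) *
            Torus.eScalarGradNormSq (θ s ⋆ Torus.kernel (ε n))) atTop := by
          refine lintegral_mono_ae (ae_restrict_of_ae_restrict_of_subset hsub' ?_)
          filter_upwards [hgood, hE0] with s hs hs0
          have hθsi : Integrable (θ s) volume := hs.1.2.1.integrable_unitAddTorus
          exact Torus.mul_eScalarGradNormSq_le_liminf hθsi
            (fun n => (Torus.isSmooth_convolution hθsi (hkS n)).integrable) hs0 ENNReal.ofReal_ne_top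
      _ ≤ liminf (fun n => ∫⁻ s in Ioo 0 t, ENNReal.ofReal (2 * κ) *
            Torus.eScalarGradNormSq (θ s ⋆ Torus.kernel (ε n))) atTop := lintegral_liminf_le' hAEm'
      _ = liminf (fun n => ENNReal.ofReal (2 * κ * ∫ s in Ioc 0 t, g n s)) atTop := by
          simp_rw [hΛ]
  -- conclusion
  rw [hX]
  refine ENNReal.le_of_forall_pos_le_add fun δ hδ _ => ?_
  have hδ' : (0 : ℝ≥0∞) < δ := ENNReal.coe_pos.2 hδ
  have hev : ∀ᶠ n in atTop, ENNReal.ofReal (∫ x, θ t x ^ 2) +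
      ENNReal.ofReal (2 * κ * ∫ s in Ioc 0 t, g n s) ≤ a + δ := by
    filter_upwards [(tendsto_order.1 he0).2 δ hδ'] with n hn
    exact (hcore n).trans (add_le_add_right hn.le a)
  obtain ⟨n₀, hn₀⟩ := hev.exists
  have hXle : ENNReal.ofReal (∫ x, θ t x ^ 2) ≤ a + δ := le_self_add.trans hn₀
  have hlim : liminf (fun n => ENNReal.ofReal (2 * κ * ∫ s in Ioc 0 t, g n s)) atTop ≤
      a + δ - ENNReal.ofReal (∫ x, θ t x ^ 2) :=
    liminf_le_of_frequently_le
      (hev.mono fun n hn => ENNReal.le_sub_of_add_le_left ENNReal.ofReal_ne_top hn).frequently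
  calc ENNReal.ofReal (∫ x, θ t x ^ 2) + 2 * Torus.eScalarDissipation κ θ 0 t
      ≤ ENNReal.ofReal (∫ x, θ t x ^ 2) +
          liminf (fun n => ENNReal.ofReal (2 * κ * ∫ s in Ioc 0 t, g n s)) atTop :=
        add_le_add_right hFatou _
    _ ≤ ENNReal.ofReal (∫ x, θ t x ^ 2) + (a + δ - ENNReal.ofReal (∫ x, θ t x ^ 2)) :=
        add_le_add_right hlim _
    _ = a + δ := add_tsub_cancel_of_le hXle

/-- **The Obukhov–Corrsin bound for ALL weak solutions above the line** (barrier audit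
2026-08-17, gen 9): the conclusion of `DrivasElgindiIyerJeong2022_thm4` — for all bounds
`K, M, κ₀` a constant `C = C(d, T, α, β, K, M, κ₀)` with
`κ ∫₀ᵀ ‖∇θ‖²_{L²} ≤ C κ^{(α+2β-1)/(α+1)}` — holds, when `1 < α + 2β`, for EVERY weak solution
`θ ∈ L^∞(0,T; L²)` of `∂ₜθ + u·∇θ = κΔθ`, `θ(0) = θ₀`, with `u ∈ L¹(0,T; C^{0,α})` divergence
free, `‖u‖_{L¹C^{0,α}} ≤ K`, `‖θ₀‖_{C^{0,β}} ≤ M`, `0 < κ ≤ κ₀` and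
`ess sup_t ‖θ(t)‖_{C^{0,β}} ≤ M`, WITHOUT the energy hypothesis (1.2) of the source — it is
supplied by `DrivasElgindiIyerJeong2022_thm4.energy_ineq_of_holder` and the bound by the
discharge `DrivasElgindiIyerJeong2022_thm4_holds`. (Below the line the displayed bound is weaker
than the trivial `½‖θ₀‖²` that (1.2) gives, so nothing of content is lost.) [cite: DrivasEtAl2022, Thm. 4] -/
theorem DrivasElgindiIyerJeong2022_thm4_of_supercritical (d : Type) [Fintype d] [DecidableEq d]
    (T : ℝ) (hT : 0 < T) (α β : ℝ≥0) (hα : 0 < α ∧ α ≤ 1) (hβ : 0 < β ∧ β ≤ 1)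
    (hOC : 1 < (α : ℝ) + 2 * β) (K M κ₀ : ℝ≥0) :
    ∃ C : ℝ≥0,
      ∀ (u : ℝ → UnitAddTorus d → EuclideanSpace ℝ d) (_hu : MemLpHolder 1 α u (Ioo 0 T))
        (_huK : eLpHolderNorm 1 α u (Ioo 0 T) ≤ K)
        (θ₀ : UnitAddTorus d → ℝ) (_hθ₀ : eBoundedHolderNorm β θ₀ ≤ M)
        (κ : ℝ) (_hκ : 0 < κ) (_hκ₀ : κ ≤ κ₀)
        (θ : ℝ → UnitAddTorus d → ℝ) (_hθ : Torus.IsWeakScalarTransportOn T κ u θ₀ θ)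
        (_hbound : ∀ᵐ t ∂(volume.restrict (Ioo 0 T)), eBoundedHolderNorm β (θ t) ≤ M),
        Torus.eScalarDissipation κ θ 0 T ≤
          ENNReal.ofReal (C * κ ^ (((α : ℝ) + 2 * β - 1) / (α + 1))) := by
  obtain ⟨C, hC⟩ := DrivasElgindiIyerJeong2022_thm4_holds d T hT α β hα hβ K M κ₀
  refine ⟨C, fun u hu huK θ₀ hθ₀ κ hκ hκ₀ θ hθ hbound => ?_⟩
  exact hC u hu huK θ₀ hθ₀ κ hκ hκ₀ θ hθ
    (DrivasElgindiIyerJeong2022_thm4.energy_ineq_of_holder hβ.1 hOC hu hθ₀ hκ.le hθ hbound) hbound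

end Literature.Barriers.AnomalousDissipation

end
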